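import Summits.BirchSwinnertonDyer.Rank1Residual.Additive.TameBranchOneValueLayer
import HarnessLib

/-!
# The one-value law WITH STICKELBERGER: `ord_p Σ_b κ(b)[b/p^{n+1+e₀}]⁺_f = λ_an/φ(pⁿ⁺¹) +
# [1/e ∣ 1 − 1/e] − c` for EVERY witness of the tame-branch package, both ways, and the SIGN read
# off the SAME value (cell `b2b-bsdres`, sub-cell additive-p2 = X3♯(G-ord)/X4♯(G-ord), gen 27;
# part 3/4)

HONEST FRAMING (cell `b2b-bsdres`, run/shared/lean/b2b/bsd-rank1-residual/, verbatim in every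
file): the goal of the cell is to DELETE the COMBINATION-SHAPED residual classes of the
Birch–Swinnerton-Dyer formula for ALL analytic-rank `≤ 1` elliptic curves over `ℚ` — "full BSD
formula for every rank `≤ 1` curve in class `C`" assembled STRICTLY from published theorems — so
that the rank-`≤ 1` remainder becomes exactly the CONSTRUCTION-SHAPED classes, which are TYPED
(missing-input `Prop`s), NOT attempted. This is not "finishing BSD". Sub-cell additive-p2: the
classes X3♯(G-ord) / X4♯(G-ord) are CONSTRUCTION-SHAPED and stay so; labels / RESIDUAL-MAP marks
UNCHANGED; nothing is booked. THEOREMS ONLY; no definition, no named fact, no `sorry`.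

## What

Parts 1–2 (`TameBranchOneValueLaw.lean`, `TameBranchOneValueLayer.lean`): for EVERY witness `B` of
`IsTameBranchOf f p ε α B` (`‖α‖ = 1`, coefficient bound `p^c`) and one even primitive `p`-power-order
`κ` of conductor `p^{n+1+e₀}`, `(p‖τ(ε,ψ_κ)‖‖S(κ)‖)^{φ(pⁿ⁺¹)} = (p^c)^{φ}·p^{−k}` iff `‖[T^k]B‖ = p^c` is
the FIRST coefficient at the bound (`k < φ(pⁿ⁺¹)`); and Stickelberger: `‖τ(ι∘ω^u)‖^e = p^{−(e−1)}`,
`‖τ(ι∘ω^{(e−1)u})‖^e = p⁻¹ = ‖τ(ι∘ω^{−u})‖^e` (`eu = p − 1`). Here `S(κ) = Σ_b κ(b)[b/p^{n+1+e₀}]⁺_f`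
ALONE is read, for `ε = ι∘χ`, `χ : (ℤ/p)^× → ℚ_p` of order `e ≥ 2`:

* **THE LAW** — `IsTameBranchOf.norm_ratTwistedSymbolSum_pow_eq_of_firstTop_of_teichmullerPow`
  (`χ = ω^u`, UNSTARRED types): first top coefficient at `k < φ` ⟹
  **`‖S(κ)‖^{e·φ} = (p^c)^{e·φ}·p^{−(e·k + φ)}`**, i.e. `ord_p S(κ) = k/φ + 1/e − c`; the primed twin
  (`χ = ω^{(e−1)u}`, STARRED types): **`‖S(κ)‖^{e·φ} = (p^c)^{e·φ}·p^{−(e·k + (e−1)φ)}`**,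
  `ord_p S(κ) = k/φ + 1 − 1/e − c` — gen 26's empirical E-GAUSSCERT law
  `v_p S(κ₁) = λ_an/(p−1) + [1/e ∣ 1 − 1/e]` (12/12 at conductor `p²`) and E-GAUSSCERT3 (13/13 at `p³`,
  `λ_an/(p(p−1)) + …`) as kernel PREDICTIONS from `λ_an` (HOME/b2b-bsdres-additive-p2/gen26/);
* **THE CERTIFICATE** — `IsTameBranchOf.firstTop_of_norm_ratTwistedSymbolSum_pow_eq[']`: the
  displayed value of `‖S(κ)‖^{e·φ}` with `k < φ` ⟹ **`‖[T^k]B‖ = p^c`, all earlier coefficients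
  `< p^c`** — the input of gen 24's at-the-bound discharge of `CharLamLeAt W p k`, for EVERY witness,
  from ONE twisted symbol sum (no Riemann sum, no forced partner);
* **THE SIGN FROM THE SAME VALUE** — `lt_mul_norm_tameGaussSum_inv_mul_norm_of_pow_eq`
  (witness-free): `χ = ω^u`, `‖S(κ)‖^{e·φ} = (p^c)^{e·φ}·p^{−(e·k+φ)}` with **`e·k < (e−2)·φ`** ⟹
  **`p^c < p‖τ(ι∘χ⁻¹,ψ_κ)‖‖S(κ)‖`** — exactly the hypothesis `hcert` of gen 26's character-free sign
  certificate `towerBounded_forced_of_thm1_of_gaussCert` (no witness with bound `p^c` for `ι∘χ⁻¹`).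
  At rank one (`k = 1`) on defect `e ∈ {3,4,6}` the side condition is `φ ≥ 4`, i.e. `p ≥ 5`: on the
  unstarred rows ONE value carries BOTH the sign bit and `λ_an = 1` (part 4).

Not claimed: which character carries a witness (part 4 decides it from print + this value); anything
booked; starred-row sign certificates (there the conjugate Gauss sum is the large one — gen 25's
certificate remains).

References: Lang, *Cyclotomic Fields I–II*, Ch. 1 §2 Thm. 2.1 (Stickelberger) [Lang1990];
Mazur–Tate–Teitelbaum 1986 §I.8, §I.13–I.14 [MazurTateTeitelbaum1986Invent]; Washington GTM 83
§7.1–7.2 [Washington1997]; HOME/b2b-bsdres-additive-p2/gen26/GAUSSCERT-CHECK.md, GAUSSCERT3-RESULT.md. -/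

set_option autoImplicit false

noncomputable section

open scoped Classical MatrixGroups ModularForm NumberField Topology

open CongruenceSubgroup IsDedekindDomain WeierstrassCurve NumberField Filter
  Literature.NumberTheory.EllipticCurves
  Literature.NumberTheory.EllipticCurves.ModularForms
  Literature.NumberTheory.EllipticCurves.Rank1Residual
  Literature.NumberTheory.GaussSums

namespace Summit.BirchSwinnertonDyer.Rank1Residual.Additive

/-! ### §5 The explicit law `[1/e ∣ 1 − 1/e]`, the certificate, and the sign from one value -/

section StickelbergerLaw

open TameBranchOneValue

variable {p : ℕ} [hp : Fact p.Prime] {N : ℕ} {f : CuspForm (Gamma0 N) 2}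

/-- **THE LAW, UNSTARRED: `ord_p S(κ) = λ_an/φ(pⁿ⁺¹) + 1/e − c`.** For `χ = ω^u` the Teichmüller power
of the small exponent (order `e ≥ 2`, `eu = p − 1`), EVERY witness `B` of `IsTameBranchOf f p (ι∘χ) α B`
(`‖α‖ = 1`, coefficient bound `p^c`, FIRST top coefficient at `k`) and every even primitive
`p`-power-order `κ` of conductor `p^{n+1+e₀}` with `k < φ(pⁿ⁺¹)`:
**`‖Σ_b κ(b)[b/p^{n+1+e₀}]⁺_f‖^{e·φ(pⁿ⁺¹)} = (p^c)^{e·φ(pⁿ⁺¹)}·p^{−(e·k + φ(pⁿ⁺¹))}`** — gen 26's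
E-GAUSSCERT law (`λ_an/(p−1) + 1/e` at conductor `p²`) as a theorem.
[cite: Lang1990, Ch. 1 §2 Thm. 2.1] [cite: MazurTateTeitelbaum1986Invent, §I.8, §I.13–I.14]
[cite: Washington1997, §7.1–7.2 (shape)] -/
theorem IsTameBranchOf.norm_ratTwistedSymbolSum_pow_eq_of_firstTop_of_teichmullerPow
    {χ : MulChar (ZMod p) ℚ_[p]} {α : ℚ_[p]} {B : PowerSeries ℚ_[p]}
    (h : IsTameBranchOf f p (χ.ringHomComp (algebraMap ℚ_[p] ℂ_[p])) α B) (hα : ‖α‖ = 1) {c : ℕ}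
    (hbd : ∀ j : ℕ, ‖PowerSeries.coeff j B‖ ≤ (p : ℝ) ^ c)
    {k : ℕ} (hk : ‖PowerSeries.coeff k B‖ = (p : ℝ) ^ c)
    (hlt : ∀ i < k, ‖PowerSeries.coeff i B‖ < (p : ℝ) ^ c)
    {u e : ℕ} (hteich : ∀ a : ZMod p, a ≠ 0 → ‖χ a - ((a.val : ℕ) : ℚ_[p]) ^ u‖ < 1)
    (hχe : orderOf χ = e) (h2 : 2 ≤ e) (hu : e * u = p - 1)
    {n : ℕ} {κ : DirichletCharacter ℂ_[p] (p ^ (n + 1 + cyclotomicExponent p))} (hκ : κ.IsPrimitive)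
    (heven : κ.Even) (hord : ∃ j : ℕ, orderOf κ = p ^ j) (hkφ : k < Nat.totient (p ^ (n + 1))) :
    ‖ratTwistedSymbolSum f κ‖ ^ (e * Nat.totient (p ^ (n + 1))) =
      ((p : ℝ) ^ c) ^ (e * Nat.totient (p ^ (n + 1))) *
        ((p : ℝ)⁻¹) ^ (e * k + Nat.totient (p ^ (n + 1))) := by
  have hp0 : (p : ℝ) ≠ 0 := Nat.cast_ne_zero.mpr hp.out.ne_zero
  set φ := Nat.totient (p ^ (n + 1)) with hφ_def
  set T := ‖tameGaussSum p (χ.ringHomComp (algebraMap ℚ_[p] ℂ_[p])) κ‖ with hT_def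
  set S := ‖ratTwistedSymbolSum f κ‖ with hS_def
  have hX := h.pow_totient_eq_of_firstTop hα hbd hk hlt hκ heven hord hkφ
  have hτ := norm_tameGaussSum_pow_eq_of_teichmullerPow hteich hχe h2 hu
    (two_le_add_one_add_cyclotomicExponent n) hκ
  -- `X^e = p · S^e`
  have hXe : ((p : ℝ) * T * S) ^ e = p * S ^ e := by
    rw [mul_pow, mul_pow, hT_def, hτ, pow_mul_inv_pow_sub_one (by omega)]
  -- compare `X^{eφ}` computed two ways
  have h1 : ((p : ℝ) * T * S) ^ (e * φ) = (p : ℝ) ^ φ * S ^ (e * φ) := by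
    rw [pow_mul, hXe]; ring
  have h2' : ((p : ℝ) * T * S) ^ (e * φ) = ((p : ℝ) ^ c) ^ (e * φ) * ((p : ℝ)⁻¹) ^ (e * k) := by
    rw [mul_comm e φ, pow_mul, hX]; ring
  have hpφ : (p : ℝ) ^ φ ≠ 0 := pow_ne_zero _ hp0
  calc S ^ (e * φ) = ((p : ℝ) ^ φ)⁻¹ * ((p : ℝ) ^ φ * S ^ (e * φ)) := by
        rw [inv_mul_cancel_left₀ hpφ]
    _ = ((p : ℝ) ^ φ)⁻¹ * (((p : ℝ) ^ c) ^ (e * φ) * ((p : ℝ)⁻¹) ^ (e * k)) := by rw [← h1, h2']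
    _ = ((p : ℝ) ^ c) ^ (e * φ) * ((p : ℝ)⁻¹) ^ (e * k + φ) := by rw [← inv_pow]; ring

/-- **THE LAW, STARRED: `ord_p S(κ) = λ_an/φ(pⁿ⁺¹) + 1 − 1/e − c`.** For `χ = ω^{(e−1)u}` the
Teichmüller power of the large exponent (order `e ≥ 2`, `eu = p − 1`; the STARRED Kodaira types
IV*/III*/II* carry this bounded character), every witness with first top coefficient at `k < φ`:
**`‖S(κ)‖^{e·φ} = (p^c)^{e·φ}·p^{−(e·k + (e−1)·φ)}`**. [cite: Lang1990, Ch. 1 §2 Thm. 2.1]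
[cite: MazurTateTeitelbaum1986Invent, §I.8, §I.13–I.14] [cite: Washington1997, §7.1–7.2 (shape)] -/
theorem IsTameBranchOf.norm_ratTwistedSymbolSum_pow_eq_of_firstTop_of_teichmullerPow'
    {χ : MulChar (ZMod p) ℚ_[p]} {α : ℚ_[p]} {B : PowerSeries ℚ_[p]}
    (h : IsTameBranchOf f p (χ.ringHomComp (algebraMap ℚ_[p] ℂ_[p])) α B) (hα : ‖α‖ = 1) {c : ℕ}
    (hbd : ∀ j : ℕ, ‖PowerSeries.coeff j B‖ ≤ (p : ℝ) ^ c)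
    {k : ℕ} (hk : ‖PowerSeries.coeff k B‖ = (p : ℝ) ^ c)
    (hlt : ∀ i < k, ‖PowerSeries.coeff i B‖ < (p : ℝ) ^ c)
    {u e : ℕ} (hteich : ∀ a : ZMod p, a ≠ 0 → ‖χ a - ((a.val : ℕ) : ℚ_[p]) ^ ((e - 1) * u)‖ < 1)
    (hχe : orderOf χ = e) (h2 : 2 ≤ e) (hu : e * u = p - 1)
    {n : ℕ} {κ : DirichletCharacter ℂ_[p] (p ^ (n + 1 + cyclotomicExponent p))} (hκ : κ.IsPrimitive)
    (heven : κ.Even) (hord : ∃ j : ℕ, orderOf κ = p ^ j) (hkφ : k < Nat.totient (p ^ (n + 1))) :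
    ‖ratTwistedSymbolSum f κ‖ ^ (e * Nat.totient (p ^ (n + 1))) =
      ((p : ℝ) ^ c) ^ (e * Nat.totient (p ^ (n + 1))) *
        ((p : ℝ)⁻¹) ^ (e * k + (e - 1) * Nat.totient (p ^ (n + 1))) := by
  have hp0 : (p : ℝ) ≠ 0 := Nat.cast_ne_zero.mpr hp.out.ne_zero
  set φ := Nat.totient (p ^ (n + 1)) with hφ_def
  set T := ‖tameGaussSum p (χ.ringHomComp (algebraMap ℚ_[p] ℂ_[p])) κ‖ with hT_def
  set S := ‖ratTwistedSymbolSum f κ‖ with hS_def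
  have hX := h.pow_totient_eq_of_firstTop hα hbd hk hlt hκ heven hord hkφ
  have hτ := norm_tameGaussSum_pow_eq_of_teichmullerPow' hteich hχe h2 hu
    (two_le_add_one_add_cyclotomicExponent n) hκ
  -- `X^e = p^e · p⁻¹ · S^e = p^{e−1} S^e`
  have hXe : ((p : ℝ) * T * S) ^ e = (p : ℝ) ^ (e - 1) * S ^ e := by
    rw [mul_pow, mul_pow, hT_def, hτ, pow_mul_inv_eq_pow_sub_one (by omega)]
  have h1 : ((p : ℝ) * T * S) ^ (e * φ) = (p : ℝ) ^ ((e - 1) * φ) * S ^ (e * φ) := by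
    rw [pow_mul, hXe, mul_pow, ← pow_mul, ← pow_mul]
  have h2' : ((p : ℝ) * T * S) ^ (e * φ) = ((p : ℝ) ^ c) ^ (e * φ) * ((p : ℝ)⁻¹) ^ (e * k) := by
    rw [mul_comm e φ, pow_mul, hX]; ring
  have hpφ : (p : ℝ) ^ ((e - 1) * φ) ≠ 0 := pow_ne_zero _ hp0
  calc S ^ (e * φ) = ((p : ℝ) ^ ((e - 1) * φ))⁻¹ * ((p : ℝ) ^ ((e - 1) * φ) * S ^ (e * φ)) := by
        rw [inv_mul_cancel_left₀ hpφ]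
    _ = ((p : ℝ) ^ ((e - 1) * φ))⁻¹ * (((p : ℝ) ^ c) ^ (e * φ) * ((p : ℝ)⁻¹) ^ (e * k)) := by
        rw [← h1, h2']
    _ = ((p : ℝ) ^ c) ^ (e * φ) * ((p : ℝ)⁻¹) ^ (e * k + (e - 1) * φ) := by rw [← inv_pow]; ring

/-- **THE CERTIFICATE, UNSTARRED.** `χ = ω^u` (small exponent, order `e ≥ 2`, `eu = p − 1`), EVERY
witness `B` of `IsTameBranchOf f p (ι∘χ) α B` (`‖α‖ = 1`, bound `p^c`), ONE even primitive `p`-power-order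
`κ` of conductor `p^{n+1+e₀}` and `k < φ(pⁿ⁺¹)` with
**`‖Σ_b κ(b)[b/p^{n+1+e₀}]⁺_f‖^{e·φ} = (p^c)^{e·φ}·p^{−(e·k + φ)}`** ⟹ **`‖[T^k]B‖ = p^c`, all earlier
coefficients `< p^c`**. [cite: Lang1990, Ch. 1 §2 Thm. 2.1]
[cite: MazurTateTeitelbaum1986Invent, §I.8, §I.13–I.14] [cite: Washington1997, §7.1–7.2 (shape)] -/
theorem IsTameBranchOf.firstTop_of_norm_ratTwistedSymbolSum_pow_eq
    {χ : MulChar (ZMod p) ℚ_[p]} {α : ℚ_[p]} {B : PowerSeries ℚ_[p]}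
    (h : IsTameBranchOf f p (χ.ringHomComp (algebraMap ℚ_[p] ℂ_[p])) α B) (hα : ‖α‖ = 1) {c : ℕ}
    (hbd : ∀ j : ℕ, ‖PowerSeries.coeff j B‖ ≤ (p : ℝ) ^ c)
    {u e : ℕ} (hteich : ∀ a : ZMod p, a ≠ 0 → ‖χ a - ((a.val : ℕ) : ℚ_[p]) ^ u‖ < 1)
    (hχe : orderOf χ = e) (h2 : 2 ≤ e) (hu : e * u = p - 1)
    {n : ℕ} {κ : DirichletCharacter ℂ_[p] (p ^ (n + 1 + cyclotomicExponent p))} (hκ : κ.IsPrimitive)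
    (heven : κ.Even) (hord : ∃ j : ℕ, orderOf κ = p ^ j) {k : ℕ} (hkφ : k < Nat.totient (p ^ (n + 1)))
    (hval : ‖ratTwistedSymbolSum f κ‖ ^ (e * Nat.totient (p ^ (n + 1))) =
      ((p : ℝ) ^ c) ^ (e * Nat.totient (p ^ (n + 1))) *
        ((p : ℝ)⁻¹) ^ (e * k + Nat.totient (p ^ (n + 1)))) :
    ‖PowerSeries.coeff k B‖ = (p : ℝ) ^ c ∧ ∀ i < k, ‖PowerSeries.coeff i B‖ < (p : ℝ) ^ c := by
  have hp0 : (p : ℝ) ≠ 0 := Nat.cast_ne_zero.mpr hp.out.ne_zero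
  set φ := Nat.totient (p ^ (n + 1)) with hφ_def
  set T := ‖tameGaussSum p (χ.ringHomComp (algebraMap ℚ_[p] ℂ_[p])) κ‖ with hT_def
  set S := ‖ratTwistedSymbolSum f κ‖ with hS_def
  have hτ := norm_tameGaussSum_pow_eq_of_teichmullerPow hteich hχe h2 hu
    (two_le_add_one_add_cyclotomicExponent n) hκ
  have hXe : ((p : ℝ) * T * S) ^ e = p * S ^ e := by
    rw [mul_pow, mul_pow, hT_def, hτ, pow_mul_inv_pow_sub_one (by omega)]
  -- `X^{eφ} = ((p^c)^φ p^{-k})^e`, hence `X^φ = (p^c)^φ p^{-k}`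
  have h1 : ((p : ℝ) * T * S) ^ (e * φ) = (p : ℝ) ^ φ * S ^ (e * φ) := by
    rw [pow_mul, hXe]; ring
  have hXφ : (((p : ℝ) * T * S) ^ φ) ^ e = (((p : ℝ) ^ c) ^ φ * ((p : ℝ)⁻¹) ^ k) ^ e := by
    rw [← pow_mul, mul_comm φ e, h1, hval]
    have hc1 : (p : ℝ) ^ φ * ((p : ℝ)⁻¹) ^ φ = 1 := by rw [← mul_pow, mul_inv_cancel₀ hp0, one_pow]
    calc (p : ℝ) ^ φ * (((p : ℝ) ^ c) ^ (e * φ) * ((p : ℝ)⁻¹) ^ (e * k + φ))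
        = ((p : ℝ) ^ φ * ((p : ℝ)⁻¹) ^ φ) * (((p : ℝ) ^ c) ^ (e * φ) * ((p : ℝ)⁻¹) ^ (e * k)) := by
          ring
      _ = (((p : ℝ) ^ c) ^ φ * ((p : ℝ)⁻¹) ^ k) ^ e := by rw [hc1, one_mul]; ring
  have hval' : ((p : ℝ) * T * S) ^ φ = ((p : ℝ) ^ c) ^ φ * ((p : ℝ)⁻¹) ^ k :=
    (pow_left_inj₀ (by positivity) (by positivity) (by omega : e ≠ 0)).mp hXφ
  exact h.firstTop_of_pow_totient_eq hα hbd hκ heven hord hkφ hval'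

/-- **THE CERTIFICATE, STARRED.** `χ = ω^{(e−1)u}` (large exponent), every witness with bound `p^c`,
ONE `κ` of conductor `p^{n+1+e₀}` and `k < φ(pⁿ⁺¹)` with
**`‖S(κ)‖^{e·φ} = (p^c)^{e·φ}·p^{−(e·k + (e−1)φ)}`** ⟹ `‖[T^k]B‖ = p^c` first top.
[cite: Lang1990, Ch. 1 §2 Thm. 2.1] [cite: MazurTateTeitelbaum1986Invent, §I.8, §I.13–I.14]
[cite: Washington1997, §7.1–7.2 (shape)] -/
theorem IsTameBranchOf.firstTop_of_norm_ratTwistedSymbolSum_pow_eq'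
    {χ : MulChar (ZMod p) ℚ_[p]} {α : ℚ_[p]} {B : PowerSeries ℚ_[p]}
    (h : IsTameBranchOf f p (χ.ringHomComp (algebraMap ℚ_[p] ℂ_[p])) α B) (hα : ‖α‖ = 1) {c : ℕ}
    (hbd : ∀ j : ℕ, ‖PowerSeries.coeff j B‖ ≤ (p : ℝ) ^ c)
    {u e : ℕ} (hteich : ∀ a : ZMod p, a ≠ 0 → ‖χ a - ((a.val : ℕ) : ℚ_[p]) ^ ((e - 1) * u)‖ < 1)
    (hχe : orderOf χ = e) (h2 : 2 ≤ e) (hu : e * u = p - 1)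
    {n : ℕ} {κ : DirichletCharacter ℂ_[p] (p ^ (n + 1 + cyclotomicExponent p))} (hκ : κ.IsPrimitive)
    (heven : κ.Even) (hord : ∃ j : ℕ, orderOf κ = p ^ j) {k : ℕ} (hkφ : k < Nat.totient (p ^ (n + 1)))
    (hval : ‖ratTwistedSymbolSum f κ‖ ^ (e * Nat.totient (p ^ (n + 1))) =
      ((p : ℝ) ^ c) ^ (e * Nat.totient (p ^ (n + 1))) *
        ((p : ℝ)⁻¹) ^ (e * k + (e - 1) * Nat.totient (p ^ (n + 1)))) :
    ‖PowerSeries.coeff k B‖ = (p : ℝ) ^ c ∧ ∀ i < k, ‖PowerSeries.coeff i B‖ < (p : ℝ) ^ c := by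
  have hp0 : (p : ℝ) ≠ 0 := Nat.cast_ne_zero.mpr hp.out.ne_zero
  set φ := Nat.totient (p ^ (n + 1)) with hφ_def
  set T := ‖tameGaussSum p (χ.ringHomComp (algebraMap ℚ_[p] ℂ_[p])) κ‖ with hT_def
  set S := ‖ratTwistedSymbolSum f κ‖ with hS_def
  have hτ := norm_tameGaussSum_pow_eq_of_teichmullerPow' hteich hχe h2 hu
    (two_le_add_one_add_cyclotomicExponent n) hκ
  have hXe : ((p : ℝ) * T * S) ^ e = (p : ℝ) ^ (e - 1) * S ^ e := by
    rw [mul_pow, mul_pow, hT_def, hτ, pow_mul_inv_eq_pow_sub_one (by omega)]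
  have h1 : ((p : ℝ) * T * S) ^ (e * φ) = (p : ℝ) ^ ((e - 1) * φ) * S ^ (e * φ) := by
    rw [pow_mul, hXe, mul_pow, ← pow_mul, ← pow_mul]
  have hXφ : (((p : ℝ) * T * S) ^ φ) ^ e = (((p : ℝ) ^ c) ^ φ * ((p : ℝ)⁻¹) ^ k) ^ e := by
    rw [← pow_mul, mul_comm φ e, h1, hval]
    have hc1 : (p : ℝ) ^ ((e - 1) * φ) * ((p : ℝ)⁻¹) ^ ((e - 1) * φ) = 1 := by
      rw [← mul_pow, mul_inv_cancel₀ hp0, one_pow]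
    calc (p : ℝ) ^ ((e - 1) * φ) * (((p : ℝ) ^ c) ^ (e * φ) * ((p : ℝ)⁻¹) ^ (e * k + (e - 1) * φ))
        = ((p : ℝ) ^ ((e - 1) * φ) * ((p : ℝ)⁻¹) ^ ((e - 1) * φ)) *
            (((p : ℝ) ^ c) ^ (e * φ) * ((p : ℝ)⁻¹) ^ (e * k)) := by ring
      _ = (((p : ℝ) ^ c) ^ φ * ((p : ℝ)⁻¹) ^ k) ^ e := by rw [hc1, one_mul]; ring
  have hval' : ((p : ℝ) * T * S) ^ φ = ((p : ℝ) ^ c) ^ φ * ((p : ℝ)⁻¹) ^ k :=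
    (pow_left_inj₀ (by positivity) (by positivity) (by omega : e ≠ 0)).mp hXφ
  exact h.firstTop_of_pow_totient_eq hα hbd hκ heven hord hkφ hval'

/-- **THE SIGN FROM THE SAME VALUE (witness-free).** `χ = ω^u` (small exponent, order `e ≥ 2`,
`eu = p − 1`), `κ` even primitive of `p`-power order and conductor `p^{n+1+e₀}`; if
`‖S(κ)‖^{e·φ} = (p^c)^{e·φ}·p^{−(e·k + φ)}` with **`e·k < (e − 2)·φ(pⁿ⁺¹)`** then
**`p^c < p·‖τ(ι∘χ⁻¹, ψ_κ)‖·‖S(κ)‖`** — the hypothesis `hcert` of gen 26's character-free sign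
certificate `towerBounded_forced_of_thm1_of_gaussCert` (no witness with bound `p^c` exists for
`(ι∘χ⁻¹, ·)`). At rank one (`k = 1`) on defect `e ∈ {3,4,6}` the side condition holds as soon as
`φ ≥ 4`. [cite: Lang1990, Ch. 1 §2 Thm. 2.1] [cite: MazurTateTeitelbaum1986Invent, §I.8, §I.14] -/
theorem lt_mul_norm_tameGaussSum_inv_mul_norm_of_pow_eq {χ : MulChar (ZMod p) ℚ_[p]} {c u e : ℕ}
    (hteich : ∀ a : ZMod p, a ≠ 0 → ‖χ a - ((a.val : ℕ) : ℚ_[p]) ^ u‖ < 1)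
    (hχe : orderOf χ = e) (h2 : 2 ≤ e) (hu : e * u = p - 1)
    {n : ℕ} {κ : DirichletCharacter ℂ_[p] (p ^ (n + 1 + cyclotomicExponent p))} (hκ : κ.IsPrimitive)
    {k : ℕ} (hke : e * k < (e - 2) * Nat.totient (p ^ (n + 1)))
    (hval : ‖ratTwistedSymbolSum f κ‖ ^ (e * Nat.totient (p ^ (n + 1))) =
      ((p : ℝ) ^ c) ^ (e * Nat.totient (p ^ (n + 1))) *
        ((p : ℝ)⁻¹) ^ (e * k + Nat.totient (p ^ (n + 1)))) :
    (p : ℝ) ^ c <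
      (p : ℝ) * ‖tameGaussSum p (χ⁻¹.ringHomComp (algebraMap ℚ_[p] ℂ_[p])) κ‖ *
        ‖ratTwistedSymbolSum f κ‖ := by
  have hp0 : (p : ℝ) ≠ 0 := Nat.cast_ne_zero.mpr hp.out.ne_zero
  have hp1 : (1 : ℝ) < p := by exact_mod_cast hp.out.one_lt
  set φ := Nat.totient (p ^ (n + 1)) with hφ_def
  set T' := ‖tameGaussSum p (χ⁻¹.ringHomComp (algebraMap ℚ_[p] ℂ_[p])) κ‖ with hT'_def
  set S := ‖ratTwistedSymbolSum f κ‖ with hS_def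
  have hτ' := norm_tameGaussSum_inv_pow_eq_of_teichmullerPow hteich hχe h2 hu
    (two_le_add_one_add_cyclotomicExponent n) hκ
  -- `X'^e = p^{e−1} S^e`, `X'^{eφ} = p^{(e−1)φ} S^{eφ}`
  have hXe : ((p : ℝ) * T' * S) ^ e = (p : ℝ) ^ (e - 1) * S ^ e := by
    rw [mul_pow, mul_pow, hT'_def, hτ', pow_mul_inv_eq_pow_sub_one (by omega)]
  have h1 : ((p : ℝ) * T' * S) ^ (e * φ) = (p : ℝ) ^ ((e - 1) * φ) * S ^ (e * φ) := by
    rw [pow_mul, hXe, mul_pow, ← pow_mul, ← pow_mul]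
  -- the exponent comparison `e k + φ < (e−1) φ`
  have hlt : e * k + φ < (e - 1) * φ := by
    have : (e - 1) * φ = (e - 2) * φ + φ := by
      rw [show e - 1 = (e - 2) + 1 by omega, Nat.add_mul, one_mul]
    omega
  have hkey : ((p : ℝ) ^ c) ^ (e * φ) < ((p : ℝ) * T' * S) ^ (e * φ) := by
    rw [h1, hval]
    have hsplit : (p : ℝ) ^ ((e - 1) * φ) =
        (p : ℝ) ^ ((e - 1) * φ - (e * k + φ)) * (p : ℝ) ^ (e * k + φ) := by
      rw [← pow_add, Nat.sub_add_cancel hlt.le]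
    have hcancel : (p : ℝ) ^ (e * k + φ) * ((p : ℝ)⁻¹) ^ (e * k + φ) = 1 := by
      rw [← mul_pow, mul_inv_cancel₀ hp0, one_pow]
    have hgt : 1 < (p : ℝ) ^ ((e - 1) * φ - (e * k + φ)) :=
      one_lt_pow₀ hp1 (by omega)
    calc ((p : ℝ) ^ c) ^ (e * φ) = 1 * ((p : ℝ) ^ c) ^ (e * φ) := (one_mul _).symm
      _ < (p : ℝ) ^ ((e - 1) * φ - (e * k + φ)) * ((p : ℝ) ^ c) ^ (e * φ) := by
          gcongr
      _ = (p : ℝ) ^ ((e - 1) * φ) * (((p : ℝ) ^ c) ^ (e * φ) * ((p : ℝ)⁻¹) ^ (e * k + φ)) := by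
          rw [hsplit]
          calc (p : ℝ) ^ ((e - 1) * φ - (e * k + φ)) * ((p : ℝ) ^ c) ^ (e * φ)
              = (p : ℝ) ^ ((e - 1) * φ - (e * k + φ)) * ((p : ℝ) ^ c) ^ (e * φ) *
                  ((p : ℝ) ^ (e * k + φ) * ((p : ℝ)⁻¹) ^ (e * k + φ)) := by rw [hcancel, mul_one]
            _ = _ := by ring
  exact lt_of_pow_lt_pow_left₀ _ (by positivity) hkey

end StickelbergerLaw

end Summit.BirchSwinnertonDyer.Rank1Residual.Additive

end
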